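import Summits.Ventures.PercRepro.RankLevelSetPlaneTen

/-!
# PercRepro — traces of covers on a `5`-point plane, and the `6`-point side (mine-4, gen 22)

The ingredients of the `10`-point primality lemma `RankLevelSetPlaneTenPrime.gprime_of_ten` (the `f(5) ≤ 19`
lever of the `q = 5` window), in the `Set` vocabulary of `RankLevelSetPrimeCover` (`GClosed`, `GPrime`,
`exists_cover_of_free`, coloops allowed):

* small facts: rank `≤ 2` ⇒ `≤ 3` points, `≥ 4` points ⇒ rank `≥ 3`, `≥ 7` points ⇒ rank `≥ 4`; proper `G`-closed
  subsets of a rank-`≤ 4` set have rank `≤ 3` (`eRk_le_three_of_gclosed_of_notMem` / `_of_ne`); proper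
  `G`-closed subsets of a rank-`≤ 3` closed set are lines (`line_of_gclosed_ssubset`); a set containing a
  `G`-closed `A` with no larger rank lies in `A` (`subset_of_gclosed_of_eRk_le`);
* **`false_of_six_side`** — a `10`-point rank-`≤ 4` set `H` is not covered by `H`-closed `C, D` with `|C| = 6`,
  `D ≠ H`: `C` is prime (K2′), so for each of the `4` points `y ∉ C` one side of the cover of `y` IS `C` and
  the other traps the remaining `3` points in a line; two such triples share two points, so by submodularity
  `H ∖ C` is a `4`-point line;
* **`traces_eq_of_meet`** (K5 twice) — for covers `(F₁ y, F₂ y)` of the points of `B` through two fixed lines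
  `m₁ ⊆ F₁ y`, `m₂ ⊆ F₂ y` disjoint from `B`: two `P`-traces `F₁ y ∩ B`, `F₁ y′ ∩ B` that meet are equal and
  leave only `{y, y′}` outside;
* **`false_of_traces_meet`** — when `B` is a `5`-point plane two meeting `P`-traces are impossible: the common
  trace `P` is a `3`-point line, a point `w ∈ P` has its own `P`-trace disjoint from `P`, so `Q_w ⊇ P ∖ {w}`
  and two points span the line: `P ⊆ Q_w ∌ w`.
Axioms: standard.
-/

open scoped Matroid

namespace PercRepro

namespace ThmN

variable {α : Type}

/-- Rank `≤ 2` means `≤ 3` points on the `e`-free core. -/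
theorem ncard_le_three_of_eRk_le_two_of_free (M : Matroid α) [M.Finite]
    (hfree : ∀ e ∈ M.E, ∃ A ⊆ M.E \ {e}, e ∉ M.closure A ∧ e ∉ M.closure ((M.E \ {e}) \ A))
    {C : Set α} (hC : C ⊆ M.E) (hr : M.eRk C ≤ 2) : C.ncard ≤ 3 := by
  have := ncard_add_one_le_two_pow_of_eRk_le M (not_isLoop_of_free M hfree) hfree 2 C hC hr
  omega

/-- `≥ 4` points force rank `≥ 3` on the `e`-free core. -/
theorem three_le_eRk_of_four_le_ncard_of_free (M : Matroid α) [M.Finite]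
    (hfree : ∀ e ∈ M.E, ∃ A ⊆ M.E \ {e}, e ∉ M.closure A ∧ e ∉ M.closure ((M.E \ {e}) \ A))
    {C : Set α} (hC : C ⊆ M.E) (h4 : 4 ≤ C.ncard) : (3 : ℕ∞) ≤ M.eRk C := by
  by_contra hlt
  push Not at hlt
  have h3 : (3 : ℕ∞) = 2 + 1 := by norm_num
  rw [h3] at hlt
  have := ncard_le_three_of_eRk_le_two_of_free M hfree hC (Order.le_of_lt_add_one hlt)
  omega

/-- `≥ 7` points force rank `≥ 4` on the `e`-free core. -/
theorem four_le_eRk_of_seven_le_ncard_of_free (M : Matroid α) [M.Finite]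
    (hfree : ∀ e ∈ M.E, ∃ A ⊆ M.E \ {e}, e ∉ M.closure A ∧ e ∉ M.closure ((M.E \ {e}) \ A))
    {C : Set α} (hC : C ⊆ M.E) (h7 : 7 ≤ C.ncard) : (4 : ℕ∞) ≤ M.eRk C := by
  by_contra hlt
  push Not at hlt
  have h4 : (4 : ℕ∞) = 3 + 1 := by norm_num
  rw [h4] at hlt
  have := ncard_le_six_of_eRk_le_three_of_free M hfree hC (Order.le_of_lt_add_one hlt)
  omega

/-- A `G`-closed set missing a point of `G` has rank `≤ 3` when `r(G) ≤ 4`. -/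
theorem eRk_le_three_of_gclosed_of_notMem (M : Matroid α) [M.Finite] {G C : Set α} (hG : G ⊆ M.E)
    (hr : M.eRk G ≤ 4) (hC : GClosed M G C) {y : α} (hy : y ∈ G) (hyC : y ∉ C) : M.eRk C ≤ 3 := by
  have h1 : M.eRk C < (4 : ℕ∞) := lt_of_lt_of_le (eRk_lt_of_gclosed_ssubset M hG hC hy hyC) hr
  have h4 : (4 : ℕ∞) = 3 + 1 := by norm_num
  rw [h4] at h1
  exact Order.le_of_lt_add_one h1

/-- A proper `G`-closed subset of `G` has rank `≤ 3` when `r(G) ≤ 4`. -/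
theorem eRk_le_three_of_gclosed_of_ne (M : Matroid α) [M.Finite] {G C : Set α} (hG : G ⊆ M.E)
    (hr : M.eRk G ≤ 4) (hC : GClosed M G C) (hne : C ≠ G) : M.eRk C ≤ 3 := by
  obtain ⟨y, hyG, hyC⟩ : ∃ y ∈ G, y ∉ C := by
    by_contra hall
    push Not at hall
    exact hne (Set.Subset.antisymm hC.1 hall)
  exact eRk_le_three_of_gclosed_of_notMem M hG hr hC hyG hyC

/-- A proper `G`-closed subset `D` of a `G`-closed set `C` of rank `≤ 3` is a line: rank `≤ 2`, `≤ 3` points. -/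
theorem line_of_gclosed_ssubset (M : Matroid α) [M.Finite]
    (hfree : ∀ e ∈ M.E, ∃ A ⊆ M.E \ {e}, e ∉ M.closure A ∧ e ∉ M.closure ((M.E \ {e}) \ A))
    {G C D : Set α} (hG : G ⊆ M.E) (hC : GClosed M G C) (hrC : M.eRk C ≤ 3) (hD : GClosed M G D)
    (hDC : D ⊆ C) (hne : D ≠ C) : M.eRk D ≤ 2 ∧ D.ncard ≤ 3 := by
  obtain ⟨y, hyC, hyD⟩ : ∃ y ∈ C, y ∉ D := by
    by_contra hall
    push Not at hall
    exact hne (Set.Subset.antisymm hDC hall)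
  have hD' : GClosed M C D := ⟨hDC, fun z hz => hD.2 ⟨hz.1, hC.1 hz.2⟩⟩
  have h1 : M.eRk D < (3 : ℕ∞) :=
    lt_of_lt_of_le (eRk_lt_of_gclosed_ssubset M (hC.1.trans hG) hD' hyC hyD) hrC
  have h3 : (3 : ℕ∞) = 2 + 1 := by norm_num
  rw [h3] at h1
  have hr2 : M.eRk D ≤ 2 := Order.le_of_lt_add_one h1
  exact ⟨hr2, ncard_le_three_of_eRk_le_two_of_free M hfree (hDC.trans (hC.1.trans hG)) hr2⟩

/-- A set `C ⊆ G` containing a `G`-closed `A` with `r(C) ≤ r(A)` lies in `A`. -/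
theorem subset_of_gclosed_of_eRk_le (M : Matroid α) [M.Finite] {G A C : Set α} (hG : G ⊆ M.E)
    (hA : GClosed M G A) (hC : C ⊆ G) (hAC : A ⊆ C) (hr : M.eRk C ≤ M.eRk A) : C ⊆ A := by
  have hCfin : C.Finite := (M.ground_finite.subset hG).subset hC
  have hcl : C ⊆ M.closure A := subset_closure_of_eRk_le M hAC (hC.trans hG) hCfin hr
  exact fun z hz => hA.2 ⟨hcl hz, hC hz⟩

/-- **A `6`-point side is impossible**: if `H` (`10` points, rank `≤ 4`) is covered by `H`-closed sets `C, D` with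
`|C| = 6` and `D ≠ H`, then `H ∖ C` is a `4`-point line — contradiction. -/
theorem false_of_six_side (M : Matroid α) [M.Finite]
    (hfree : ∀ e ∈ M.E, ∃ A ⊆ M.E \ {e}, e ∉ M.closure A ∧ e ∉ M.closure ((M.E \ {e}) \ A))
    {H C D : Set α} (hH : H ⊆ M.E) (hr : M.eRk H ≤ 4) (h10 : H.ncard = 10) (hC : GClosed M H C)
    (hD : GClosed M H D) (hcov : H ⊆ C ∪ D) (hDne : D ≠ H) (hC6 : C.ncard = 6) : False := by
  have hHfin : H.Finite := M.ground_finite.subset hH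
  have hCH : C ⊆ H := hC.1
  have hCne : C ≠ H := fun h => by rw [h] at hC6; omega
  have hrC : M.eRk C ≤ 3 := eRk_le_three_of_gclosed_of_ne M hH hr hC hCne
  have hrD : M.eRk D ≤ 3 := eRk_le_three_of_gclosed_of_ne M hH hr hD hDne
  have hpC : GPrime M H C := gprime_of_self hC (gprime_of_six M hfree (hCH.trans hH) hrC hC6)
  have hrC3 : (3 : ℕ∞) ≤ M.eRk C :=
    three_le_eRk_of_four_le_ncard_of_free M hfree (hCH.trans hH) (by omega)
  have hR4 : (H \ C).ncard = 4 := by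
    have := Set.ncard_sdiff_add_ncard_of_subset hCH hHfin
    omega
  have hRD : H \ C ⊆ D := fun z hz => by
    rcases hcov hz.1 with h | h
    · exact absurd h hz.2
    · exact h
  -- for every `y ∉ C` the other three points of `H ∖ C` have rank `≤ 2`
  have hkey : ∀ y ∈ H \ C, M.eRk ((H \ C) \ {y}) ≤ 2 := by
    intro y hy
    obtain ⟨G₁, G₂, hG₁, hG₂, hyG₁, hyG₂, hcy⟩ := exists_cover_of_free M hfree hH hy.1
    have hcovC : C ⊆ (G₁ ∩ C) ∪ (G₂ ∩ C) := by
      intro z hz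
      have hzy : z ∉ ({y} : Set α) := by
        intro h
        rw [Set.mem_singleton_iff] at h
        exact hy.2 (h ▸ hz)
      rcases hcy ⟨hCH hz, hzy⟩ with h | h
      · exact Or.inl ⟨h, hz⟩
      · exact Or.inr ⟨h, hz⟩
    have hside : ∀ G₁' G₂' : Set α, GClosed M H G₁' → GClosed M H G₂' → y ∉ G₁' → y ∉ G₂' →
        H \ {y} ⊆ G₁' ∪ G₂' → G₁' ∩ C = C → M.eRk ((H \ C) \ {y}) ≤ 2 := by
      intro G₁' G₂' hG₁' hG₂' hyG₁' hyG₂' hcy' heq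
      have hCG : C ⊆ G₁' := fun z hz => (show z ∈ G₁' ∩ C by rw [heq]; exact hz).1
      have hrG₁' : M.eRk G₁' ≤ 3 := eRk_le_three_of_gclosed_of_notMem M hH hr hG₁' hy.1 hyG₁'
      have hG₁'C : G₁' ⊆ C := subset_of_gclosed_of_eRk_le M hH hC hG₁'.1 hCG (hrG₁'.trans hrC3)
      have hsub : (H \ C) \ {y} ⊆ G₂' ∩ D := by
        intro z hz
        rcases hcy' ⟨hz.1.1, hz.2⟩ with h | h
        · exact absurd (hG₁'C h) hz.1.2
        · exact ⟨h, hRD hz.1⟩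
      have hne : G₂' ∩ D ≠ D := by
        intro h
        have : y ∈ G₂' ∩ D := by rw [h]; exact hRD hy
        exact hyG₂' this.1
      obtain ⟨hr2, -⟩ :=
        line_of_gclosed_ssubset M hfree hH hD hrD (hG₂'.inter hD) Set.inter_subset_right hne
      exact (M.eRk_mono hsub).trans hr2
    rcases hpC (G₁ ∩ C) (G₂ ∩ C) (hG₁.inter hC) (hG₂.inter hC) Set.inter_subset_right
        Set.inter_subset_right hcovC with h | h
    · exact hside G₁ G₂ hG₁ hG₂ hyG₁ hyG₂ hcy h
    · exact hside G₂ G₁ hG₂ hG₁ hyG₂ hyG₁ (by rw [Set.union_comm]; exact hcy) h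
  -- two points `y₁ ≠ y₂` of `H ∖ C`; submodularity on the two triples
  have hRfin : (H \ C).Finite := hHfin.subset Set.sdiff_subset
  obtain ⟨y₁, hy₁, y₂, hy₂, hne12⟩ : ∃ y₁ ∈ H \ C, ∃ y₂ ∈ H \ C, y₁ ≠ y₂ := by
    rw [← Set.one_lt_ncard hRfin]
    omega
  have hr1 := hkey y₁ hy₁
  have hr2 := hkey y₂ hy₂
  have hunion : ((H \ C) \ {y₁}) ∪ ((H \ C) \ {y₂}) = H \ C := by
    apply Set.Subset.antisymm
    · exact Set.union_subset Set.sdiff_subset Set.sdiff_subset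
    · intro z hz
      by_cases h : z = y₁
      · exact Or.inr ⟨hz, fun h' => hne12 (h.symm.trans (Set.mem_singleton_iff.1 h'))⟩
      · exact Or.inl ⟨hz, fun h' => h (Set.mem_singleton_iff.1 h')⟩
  have hinter : ((H \ C) \ {y₁}) ∩ ((H \ C) \ {y₂}) = (H \ C) \ {y₁, y₂} := by
    ext z
    simp only [Set.mem_inter_iff, Set.mem_sdiff, Set.mem_singleton_iff, Set.mem_insert_iff, not_or]
    tauto
  have hpair : ({y₁, y₂} : Set α) ⊆ H \ C := Set.insert_subset hy₁ (Set.singleton_subset_iff.2 hy₂)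
  have hint2 : 2 ≤ ((H \ C) \ {y₁, y₂}).ncard := by
    have h1 := Set.ncard_sdiff_add_ncard_of_subset hpair hRfin
    have h2 : ({y₁, y₂} : Set α).ncard = 2 := Set.ncard_pair hne12
    omega
  have hrint : (2 : ℕ∞) ≤ M.eRk (((H \ C) \ {y₁}) ∩ ((H \ C) \ {y₂})) := by
    rw [hinter]
    exact two_le_eRk_of_two_le_ncard_of_free M hfree
      ((Set.sdiff_subset.trans Set.sdiff_subset).trans hH) hint2
  have hsubmod := M.eRk_inter_add_eRk_union_le ((H \ C) \ {y₁}) ((H \ C) \ {y₂})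
  rw [hunion] at hsubmod
  have hrR : M.eRk (H \ C) ≤ 2 := by
    have h4 : M.eRk (((H \ C) \ {y₁}) ∩ ((H \ C) \ {y₂})) + M.eRk (H \ C) ≤ (2 : ℕ∞) + 2 :=
      hsubmod.trans (add_le_add hr1 hr2)
    have h5 : (2 : ℕ∞) + M.eRk (H \ C) ≤ 2 + 2 := by
      calc (2 : ℕ∞) + M.eRk (H \ C) ≤ M.eRk (((H \ C) \ {y₁}) ∩ ((H \ C) \ {y₂})) + M.eRk (H \ C) := by
            gcongr
        _ ≤ 2 + 2 := h4
    exact (ENat.add_le_add_iff_left (by simp)).1 h5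
  have := ncard_le_three_of_eRk_le_two_of_free M hfree (Set.sdiff_subset.trans hH) hrR
  omega

/-- **Two meeting `P`-traces coincide** (K5 twice): for covers `(F₁ y, F₂ y)` of the points `y` of `B` whose
sides contain the fixed lines `m₁ ⊆ F₁ y`, `m₂ ⊆ F₂ y` (both disjoint from `B`), if the traces `F₁ y ∩ B` and
`F₁ y′ ∩ B` of two distinct points share a point then `F₁ y = F₁ y′` and `B ⊆ (F₁ y ∩ B) ∪ {y, y′}`. -/
theorem traces_eq_of_meet (M : Matroid α) [M.Finite]
    (hfree : ∀ e ∈ M.E, ∃ A ⊆ M.E \ {e}, e ∉ M.closure A ∧ e ∉ M.closure ((M.E \ {e}) \ A))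
    {H B m₁ m₂ : Set α} (hH : H ⊆ M.E) (hr : M.eRk H ≤ 4) (hBH : B ⊆ H)
    (hm₁ : GClosed M H m₁) (h2₁ : 2 ≤ m₁.ncard) (hm₁B : ∀ z, z ∈ m₁ → z ∈ B → False)
    (hm₂ : GClosed M H m₂) (h2₂ : 2 ≤ m₂.ncard) (hm₂B : ∀ z, z ∈ m₂ → z ∈ B → False)
    (F₁ F₂ : α → Set α)
    (hF : ∀ y ∈ B, GClosed M H (F₁ y) ∧ GClosed M H (F₂ y) ∧ y ∉ F₁ y ∧ y ∉ F₂ y ∧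
      H \ {y} ⊆ F₁ y ∪ F₂ y ∧ m₁ ⊆ F₁ y ∧ m₂ ⊆ F₂ y)
    {y y' z : α} (hy : y ∈ B) (hy' : y' ∈ B) (hne : y ≠ y') (hz : z ∈ F₁ y ∩ B)
    (hz' : z ∈ F₁ y' ∩ B) : F₁ y = F₁ y' ∧ B ⊆ (F₁ y ∩ B) ∪ {y, y'} := by
  obtain ⟨hF₁y, hF₂y, hyF₁, hyF₂, hcovy, hm₁y, hm₂y⟩ := hF y hy
  obtain ⟨hF₁y', hF₂y', hyF₁', hyF₂', hcovy', hm₁y', hm₂y'⟩ := hF y' hy'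
  have hyH : y ∈ H := hBH hy
  have hy'H : y' ∈ H := hBH hy'
  have hr₁y : M.eRk (F₁ y) ≤ 3 := eRk_le_three_of_gclosed_of_notMem M hH hr hF₁y hyH hyF₁
  have hr₁y' : M.eRk (F₁ y') ≤ 3 := eRk_le_three_of_gclosed_of_notMem M hH hr hF₁y' hy'H hyF₁'
  have hr₂y : M.eRk (F₂ y) ≤ 3 := eRk_le_three_of_gclosed_of_notMem M hH hr hF₂y hyH hyF₂
  have hzm : z ∉ m₁ := fun h => hm₁B z h hz.2
  have heq : F₁ y = F₁ y' := Set.Subset.antisymm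
    (gclosed_subset_of_line_of_mem M hfree hH hm₁ h2₁ hF₁y hF₁y' hr₁y hm₁y hm₁y' hz.1 hz'.1 hzm)
    (gclosed_subset_of_line_of_mem M hfree hH hm₁ h2₁ hF₁y' hF₁y hr₁y' hm₁y' hm₁y hz'.1 hz.1 hzm)
  refine ⟨heq, ?_⟩
  intro w hw
  by_contra hwX
  have hwP : w ∉ F₁ y := fun h => hwX (Or.inl ⟨h, hw⟩)
  have hwy : w ≠ y := fun h => hwX (Or.inr (by rw [h]; exact Set.mem_insert y {y'}))
  have hwy' : w ≠ y' := fun h => hwX (Or.inr (by rw [h]; exact Set.mem_insert_of_mem y rfl))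
  have hwQ : w ∈ F₂ y := by
    rcases hcovy ⟨hBH hw, fun h => hwy (Set.mem_singleton_iff.1 h)⟩ with h | h
    · exact absurd h hwP
    · exact h
  have hwQ' : w ∈ F₂ y' := by
    rcases hcovy' ⟨hBH hw, fun h => hwy' (Set.mem_singleton_iff.1 h)⟩ with h | h
    · exact absurd (by rw [heq]; exact h) hwP
    · exact h
  have hwm : w ∉ m₂ := fun h => hm₂B w h hw
  have hsub : F₂ y ⊆ F₂ y' :=
    gclosed_subset_of_line_of_mem M hfree hH hm₂ h2₂ hF₂y hF₂y' hr₂y hm₂y hm₂y' hwQ hwQ' hwm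
  have hy'Q : y' ∈ F₂ y := by
    rcases hcovy ⟨hy'H, fun h => hne (Set.mem_singleton_iff.1 h).symm⟩ with h | h
    · exact absurd (by rw [← heq]; exact h) hyF₁'
    · exact h
  exact hyF₂' (hsub hy'Q)

/-- **Two meeting `P`-traces are impossible** when `B` is a `5`-point plane: the common trace `P` is a `3`-point
line, a point `w ∈ P` has its own `P`-trace disjoint from `P`, so `Q_w ⊇ P ∖ {w}` (two points of the line `P`) and
`P ⊆ Q_w ∌ w`. -/
theorem false_of_traces_meet (M : Matroid α) [M.Finite]
    (hfree : ∀ e ∈ M.E, ∃ A ⊆ M.E \ {e}, e ∉ M.closure A ∧ e ∉ M.closure ((M.E \ {e}) \ A))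
    {H B m₁ m₂ : Set α} (hH : H ⊆ M.E) (hr : M.eRk H ≤ 4) (hB : GClosed M H B) (hrB : M.eRk B ≤ 3)
    (hB5 : B.ncard = 5)
    (hm₁ : GClosed M H m₁) (h2₁ : 2 ≤ m₁.ncard) (hm₁B : ∀ z, z ∈ m₁ → z ∈ B → False)
    (hm₂ : GClosed M H m₂) (h2₂ : 2 ≤ m₂.ncard) (hm₂B : ∀ z, z ∈ m₂ → z ∈ B → False)
    (F₁ F₂ : α → Set α)
    (hF : ∀ y ∈ B, GClosed M H (F₁ y) ∧ GClosed M H (F₂ y) ∧ y ∉ F₁ y ∧ y ∉ F₂ y ∧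
      H \ {y} ⊆ F₁ y ∪ F₂ y ∧ m₁ ⊆ F₁ y ∧ m₂ ⊆ F₂ y)
    {y y' z : α} (hy : y ∈ B) (hy' : y' ∈ B) (hne : y ≠ y') (hz : z ∈ F₁ y ∩ B)
    (hz' : z ∈ F₁ y' ∩ B) : False := by
  obtain ⟨_, hcovP⟩ :=
    traces_eq_of_meet M hfree hH hr hB.1 hm₁ h2₁ hm₁B hm₂ h2₂ hm₂B F₁ F₂ hF hy hy' hne hz hz'
  obtain ⟨hF₁y, _, hyF₁, _, _, _, _⟩ := hF y hy
  have hHfin : H.Finite := M.ground_finite.subset hH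
  have hBfin : B.Finite := hHfin.subset hB.1
  have hPcl : GClosed M H (F₁ y ∩ B) := hF₁y.inter hB
  have hPne : F₁ y ∩ B ≠ B := fun h => hyF₁ (show y ∈ F₁ y ∩ B by rw [h]; exact hy).1
  obtain ⟨hrP, hP3⟩ := line_of_gclosed_ssubset M hfree hH hB hrB hPcl Set.inter_subset_right hPne
  have hPfin : (F₁ y ∩ B).Finite := hBfin.subset Set.inter_subset_right
  have hP3' : 3 ≤ (F₁ y ∩ B).ncard := by
    have h1 : B.ncard ≤ ((F₁ y ∩ B) ∪ {y, y'}).ncard :=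
      Set.ncard_le_ncard hcovP (hPfin.union ((Set.finite_singleton y').insert y))
    have h2 := Set.ncard_union_le (F₁ y ∩ B) ({y, y'} : Set α)
    have h3 : ({y, y'} : Set α).ncard = 2 := Set.ncard_pair hne
    omega
  have hzB : z ∈ B := hz.2
  have hzy : z ≠ y := fun h => hyF₁ (h ▸ hz.1)
  obtain ⟨_, hF₂z, hzF₁, hzF₂, hcovz, _, _⟩ := hF z hzB
  -- the `P`-trace of `z` misses `P`
  have hPz : ∀ v, v ∈ F₁ z ∩ B → v ∈ F₁ y ∩ B → False := by
    intro v hv hvP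
    obtain ⟨heq', -⟩ :=
      traces_eq_of_meet M hfree hH hr hB.1 hm₁ h2₁ hm₁B hm₂ h2₂ hm₂B F₁ F₂ hF hzB hy hzy hv hvP
    exact hzF₁ (by rw [heq']; exact hz.1)
  -- hence `P ∖ {z} ⊆ Q_z`, two points of the line `P`
  have hsub : (F₁ y ∩ B) \ {z} ⊆ F₂ z := by
    intro v hv
    rcases hcovz ⟨hB.1 hv.1.2, hv.2⟩ with h | h
    · exact absurd hv.1 (hPz v ⟨h, hv.1.2⟩)
    · exact h
  have h2 : 2 ≤ ((F₁ y ∩ B) ∩ F₂ z).ncard := by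
    have h1 : ((F₁ y ∩ B) \ {z}).ncard + 1 = (F₁ y ∩ B).ncard :=
      Set.ncard_sdiff_singleton_add_one hz hPfin
    calc 2 ≤ ((F₁ y ∩ B) \ {z}).ncard := by omega
      _ ≤ ((F₁ y ∩ B) ∩ F₂ z).ncard :=
        Set.ncard_le_ncard (fun v hv => ⟨hv.1, hsub hv⟩) (hPfin.subset Set.inter_subset_left)
  have hPsub : F₁ y ∩ B ⊆ F₂ z := gclosed_subset_of_two_le_inter M hfree hH hPcl hF₂z hrP h2
  exact hzF₂ (hPsub hz)

end ThmN

end PercRepro
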